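import Mathlib
import HarnessLib
import Literature.MathematicalPhysics.PowerSystems.SinusoidalCouplingSectorBound

/-!
# The Lyapunov-function-family (LFF) decay identity of Vu–Turitsyn (IEEE TPWRS 2016, §III LMI
# (QKH) and Appendix A «Proof of the Lyapunov function decay in the polytope P»)

Topic `Literature/MathematicalPhysics/PowerSystems`, namespace
`Literature.MathematicalPhysics.PowerSystems.LyapunovFunctionFamily`.
Everything below is PROVED from Mathlib (no named facts, no definitions, no new axioms).

Source (held, read this session on the page): T. L. Vu, K. Turitsyn, *Lyapunov functions family
approach to transient stability assessment*, IEEE Trans. Power Syst. 31 (2016) [VuTuritsyn2016]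
= arXiv:1409.1889 (`lit read arxiv:1409.1889`: §II bilinear form chunk p0005, §III LMI «QKH» and
the Lyapunov function chunk p0007–p0008, Appendix 9.1 chunk p0015).

> [VuTuritsyn2016 §III] «we propose to use the convex cone of Lyapunov functions defined by the
> following system of Linear Matrix Inequalities for positive, diagonal matrices K, H of size
> |E|×|E| and symmetric, positive matrix Q of size 2n×2n:  [[AᵀQ + QA, R], [Rᵀ, −2H]] ≤ 0,
> with R = QB − CᵀH − (KCA)ᵀ. For every pair Q, K satisfying these inequalities the
> corresponding Lyapunov function is V(x) = ½ xᵀQx − Σ_{kj} K_{kj}(cos δ_kj + δ_kj sin δ*_kj).»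
> [Appendix 9.1] «From (QKH), there exist matrices X, Y such that AᵀQ+QA = −XᵀX,
> QB − CᵀH − (KCA)ᵀ = −XᵀY, and −2H = −YᵀY. The derivative of V(x) along (swing3) is:
> V̇(x) = ½ẋᵀQx + ½xᵀQẋ − Σ K_{kj}(−sin δ_kj + sin δ*_kj)δ̇_kj = 0.5xᵀ(AᵀQ+QA)x − xᵀQBF + FᵀKCẋ
> … Noting that CB = 0 and YᵀY = 2H yields
> V̇(x) = −0.5(Xx − YF)ᵀ(Xx − YF) − (Cx − F)ᵀHF = −0.5(Xx−YF)ᵀ(Xx−YF) − Σ H_{kj} g_{kj},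
> where g_{kj} = (δ_kj − δ*_kj − (sin δ_kj − sin δ*_kj))(sin δ_kj − sin δ*_kj). … g_{kj} ≥ 0 for any
> |δ_kj + δ*_kj| ≤ π. Hence V̇(x) ≤ 0, ∀ x ∈ P.»

## Rendering

* The factorisation through `X, Y` is replaced by the equivalent algebraic identity
  `−½(Xx−YF)ᵀ(Xx−YF) = ½ [x; −F]ᵀ L [x; −F]` with `L = fromBlocks (AᵀQ+QA) R Rᵀ (−2H)` the LMI
  block matrix — so the typed decay identity reads
  `V̇ = ½·[x;−F]ᵀ L [x;−F] − (Cx − F)ᵀ H F` (`decay_identity`), under the printed side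
  condition `CB = 0`; it holds for ALL matrices `Q, K, H` (symmetry of `Q` is used only to derive
  the `V̇` expression along trajectories; diagonality/positivity of `H` only for the sign of the
  last term).
* `decay_nonpos_of_lmi` is the printed conclusion pointwise: `(−L).PosSemidef` (the LMI, e.g.
  from the tree's exact PSD checker on a rounded rational `(Q, K, H)`) and `(Cx − F)ᵀHF ≥ 0`
  give `V̇ ≤ 0`; `sinusoidal_dissipation_nonneg` supplies `(Cx − F)ᵀHF = Σ h_k g_k ≥ 0` for
  `H = diagonal h`, `h ≥ 0`, `F_k = sin δ_k − sin δ*_k`, `(Cx)_k = δ_k − δ*_k` on the polytope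
  `|δ_k + δ*_k| ≤ π` (with the SEP hypothesis `|δ*_k| ≤ π/2` made explicit, as in the tree file
  `SinusoidalCouplingSectorBound`, whose `dissipationTerm_nonneg` is the per-edge `g ≥ 0`).
* `lyapunov_hasDerivAt` is the first display of Appendix 9.1 for a trajectory given by
  component functions (`HasDerivAt` at the instant `t`): the derivative of
  `V = ½xᵀQx − Σ_k K_k(cos δ_k + δ_k sin δ*_k)`, `δ_k = δ*_k + (Cx)_k`, is
  `½xᵀ(AᵀQ+QA)x − xᵀQBF + FᵀKCẋ` with `ẋ = Ax − BF`; `lyapunov_deriv_nonpos` combines everything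
  («V(x) is decaying in P»).
* MODELLED: lossless network-reduced swing model in the bilinear form ẋ = Ax − BF(Cx)
  [VuTuritsyn2016 §II]; the invariance / convergence part (R = {x ∈ P : V < V_min}, LaSalle,
  Appendix 9.2–9.3) is NOT typed here.
-/

namespace Literature.MathematicalPhysics.PowerSystems.LyapunovFunctionFamily

open Matrix

variable {ι κ : Type*} [Fintype ι] [Fintype κ]

/-- `xᵀ(Nᵀy) = (Nx)ᵀy` (private helper). [folklore] -/
private theorem dot_transpose_mulVec {m n : Type*} [Fintype m] [Fintype n] (N : Matrix m n ℝ)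
    (x : n → ℝ) (y : m → ℝ) : x ⬝ᵥ (Nᵀ *ᵥ y) = (N *ᵥ x) ⬝ᵥ y := by
  rw [dotProduct_mulVec, vecMul_transpose]

/-- `xᵀ(Ny) = (Nᵀx)ᵀy` (private helper). [folklore] -/
private theorem dot_mulVec_eq_transpose {m n : Type*} [Fintype m] [Fintype n] (N : Matrix m n ℝ)
    (x : m → ℝ) (y : n → ℝ) : x ⬝ᵥ (N *ᵥ y) = (Nᵀ *ᵥ x) ⬝ᵥ y := by
  rw [dotProduct_mulVec, ← mulVec_transpose]

/-- **The LFF decay identity** (Vu–Turitsyn 2016, Appendix A, with the `X, Y` factorisation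
replaced by the LMI block matrix itself): for symmetric `Q`, `CB = 0` and
`R = QB − CᵀH − (KCA)ᵀ`, `L = [[AᵀQ+QA, R],[Rᵀ, −2H]]`, the printed derivative expression
`V̇ = ½xᵀ(AᵀQ+QA)x − xᵀQBF + FᵀKC(Ax − BF)` equals `½·[x;−F]ᵀ L [x;−F] − (Cx − F)ᵀ H F`
(the printed form is `−½‖Xx − YF‖² − (Cx−F)ᵀHF` with `L = −[X Y]ᵀ[X Y]`). The identity is
pure matrix algebra: symmetry of `Q` is not needed here (it enters only in `lyapunov_hasDerivAt`,
where `d/dt ½xᵀQx = xᵀQẋ`). [cite: VuTuritsyn2016, Appendix A (9.1) and §III eq. (QKH)] -/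
theorem decay_identity (A Q : Matrix ι ι ℝ) (B : Matrix ι κ ℝ) (C : Matrix κ ι ℝ)
    (K H : Matrix κ κ ℝ) (R : Matrix ι κ ℝ) (L : Matrix (ι ⊕ κ) (ι ⊕ κ) ℝ)
    (hCB : C * B = 0) (hR : R = Q * B - Cᵀ * H - (K * C * A)ᵀ)
    (hL : L = Matrix.fromBlocks (Aᵀ * Q + Q * A) R Rᵀ (-(2 : ℝ) • H)) (x : ι → ℝ) (F : κ → ℝ) :
    1 / 2 * (x ⬝ᵥ ((Aᵀ * Q + Q * A) *ᵥ x)) - x ⬝ᵥ (Q *ᵥ (B *ᵥ F))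
        + F ⬝ᵥ (K *ᵥ (C *ᵥ (A *ᵥ x - B *ᵥ F)))
      = 1 / 2 * (Sum.elim x (-F) ⬝ᵥ (L *ᵥ Sum.elim x (-F))) - (C *ᵥ x - F) ⬝ᵥ (H *ᵥ F) := by
  -- block quadratic form
  have hLq : Sum.elim x (-F) ⬝ᵥ (L *ᵥ Sum.elim x (-F))
      = x ⬝ᵥ ((Aᵀ * Q + Q * A) *ᵥ x) + x ⬝ᵥ (R *ᵥ (-F))
        + ((-F) ⬝ᵥ (Rᵀ *ᵥ x) + (-F) ⬝ᵥ ((-(2 : ℝ) • H) *ᵥ (-F))) := by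
    rw [hL, fromBlocks_mulVec, Sum.elim_comp_inl, Sum.elim_comp_inr, sumElim_dotProduct_sumElim,
      dotProduct_add, dotProduct_add]
  -- the cross term
  have h1 : x ⬝ᵥ (R *ᵥ (-F)) = -(x ⬝ᵥ (Q *ᵥ (B *ᵥ F))) + (C *ᵥ x) ⬝ᵥ (H *ᵥ F)
      + (K *ᵥ (C *ᵥ (A *ᵥ x))) ⬝ᵥ F := by
    rw [hR]
    simp only [sub_mulVec, mulVec_neg, dotProduct_neg, dotProduct_sub, neg_sub']
    rw [← mulVec_mulVec, ← mulVec_mulVec, dot_transpose_mulVec C, dot_transpose_mulVec (K * C * A),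
      ← mulVec_mulVec, ← mulVec_mulVec]
    ring
  have h2 : (-F) ⬝ᵥ (Rᵀ *ᵥ x) = x ⬝ᵥ (R *ᵥ (-F)) := by
    rw [dot_transpose_mulVec, dotProduct_comm]
  have h3 : (-F) ⬝ᵥ ((-(2 : ℝ) • H) *ᵥ (-F)) = -2 * (F ⬝ᵥ (H *ᵥ F)) := by
    simp only [smul_mulVec, mulVec_neg, neg_dotProduct, dotProduct_neg, dotProduct_smul,
      smul_eq_mul]
    ring
  have h4 : F ⬝ᵥ (K *ᵥ (C *ᵥ (A *ᵥ x - B *ᵥ F))) = (K *ᵥ (C *ᵥ (A *ᵥ x))) ⬝ᵥ F := by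
    rw [mulVec_sub, mulVec_mulVec F C B, hCB, zero_mulVec, sub_zero, dotProduct_comm]
  have h5 : (C *ᵥ x - F) ⬝ᵥ (H *ᵥ F) = (C *ᵥ x) ⬝ᵥ (H *ᵥ F) - F ⬝ᵥ (H *ᵥ F) :=
    sub_dotProduct _ _ _
  rw [hLq, h2, h1, h3, h4, h5]
  ring

/-- **LFF decay, pointwise** (Vu–Turitsyn 2016 §III / Appendix A «Hence V̇(x) ≤ 0, ∀ x ∈ P»):
if the LMI block matrix is negative semidefinite (`(−L).PosSemidef`) and the dissipation term
`(Cx − F)ᵀHF` is non-negative at `(x, F)`, then `V̇ = ½xᵀ(AᵀQ+QA)x − xᵀQBF + FᵀKC(Ax − BF) ≤ 0`.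
The printed positivity of `Q`, `K` is not needed for this sign statement and is not assumed.
[cite: VuTuritsyn2016, §III (QKH) and Appendix A] -/
theorem decay_nonpos_of_lmi (A Q : Matrix ι ι ℝ) (B : Matrix ι κ ℝ) (C : Matrix κ ι ℝ)
    (K H : Matrix κ κ ℝ) (R : Matrix ι κ ℝ) (L : Matrix (ι ⊕ κ) (ι ⊕ κ) ℝ)
    (hCB : C * B = 0) (hR : R = Q * B - Cᵀ * H - (K * C * A)ᵀ)
    (hL : L = Matrix.fromBlocks (Aᵀ * Q + Q * A) R Rᵀ (-(2 : ℝ) • H)) (hneg : (-L).PosSemidef)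
    (x : ι → ℝ) (F : κ → ℝ) (hdiss : 0 ≤ (C *ᵥ x - F) ⬝ᵥ (H *ᵥ F)) :
    1 / 2 * (x ⬝ᵥ ((Aᵀ * Q + Q * A) *ᵥ x)) - x ⬝ᵥ (Q *ᵥ (B *ᵥ F))
        + F ⬝ᵥ (K *ᵥ (C *ᵥ (A *ᵥ x - B *ᵥ F))) ≤ 0 := by
  rw [decay_identity A Q B C K H R L hCB hR hL x F]
  have h0 : 0 ≤ star (Sum.elim x (-F)) ⬝ᵥ ((-L) *ᵥ Sum.elim x (-F)) :=
    hneg.dotProduct_mulVec_nonneg _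
  rw [star_trivial, neg_mulVec, dotProduct_neg] at h0
  linarith

/-- **The dissipation term for the sinusoidal couplings is non-negative on the polytope**
(Appendix A: «(Cx − F)ᵀHF = Σ H_{kj} g_{kj}», «g_{kj} ≥ 0 for any |δ_kj + δ*_kj| ≤ π»): with
`H = diagonal h`, `h ≥ 0`, edge angles `δ_k` with `|δ_k + δ*_k| ≤ π`, SEP values `|δ*_k| ≤ π/2`,
`F_k = sin δ_k − sin δ*_k` and `(Cx)_k = δ_k − δ*_k`, one has `(Cx − F)ᵀHF ≥ 0` — from the
per-edge `g ≥ 0` of the tree (`SinusoidalCoupling.dissipationTerm_nonneg`).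
[cite: VuTuritsyn2016, Appendix A] -/
theorem sinusoidal_dissipation_nonneg [DecidableEq κ] (δ δs h : κ → ℝ) (hh : ∀ k, 0 ≤ h k)
    (hδs : ∀ k, |δs k| ≤ Real.pi / 2) (hP : ∀ k, |δ k + δs k| ≤ Real.pi) :
    0 ≤ ((fun k => δ k - δs k) - fun k => Real.sin (δ k) - Real.sin (δs k))
        ⬝ᵥ (diagonal h *ᵥ fun k => Real.sin (δ k) - Real.sin (δs k)) := by
  unfold dotProduct
  refine Finset.sum_nonneg fun k _ => ?_
  rw [mulVec_diagonal, Pi.sub_apply]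
  have hg := SinusoidalCoupling.dissipationTerm_nonneg (hδs k) (hP k)
  have := mul_nonneg (hh k) hg
  nlinarith [this]

/-- **`V̇` along a trajectory** (the first display of Appendix A:
«V̇(x) = ½ẋᵀQx + ½xᵀQẋ − ΣK_{kj}(−sin δ_kj + sin δ*_kj)δ̇_kj = 0.5xᵀ(AᵀQ+QA)x − xᵀQBF + FᵀKCẋ»):
for component functions `x i : ℝ → ℝ` solving `ẋ = Ax − BF` at the instant `t` (`F` the coupling
value at `t`), symmetric `Q`, `K = diagonal kK`, and edge angles `δ_k(s) = δ*_k + (Cx(s))_k`, the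
function `V(s) = ½x(s)ᵀQx(s) − Σ_k kK_k (cos δ_k(s) + δ_k(s) sin δ*_k)` has derivative
`½xᵀ(AᵀQ+QA)x − xᵀQBF + FᵀKC(Ax − BF)` at `t`, where `F_k = sin δ_k(t) − sin δ*_k`.
[cite: VuTuritsyn2016, Appendix A (first display) and §III (the Lyapunov function V)] -/
theorem lyapunov_hasDerivAt [DecidableEq κ] (A Q : Matrix ι ι ℝ) (B : Matrix ι κ ℝ)
    (C : Matrix κ ι ℝ) (kK δs : κ → ℝ) (hQ : Qᵀ = Q) (x : ι → ℝ → ℝ) (x' : ι → ℝ) (t : ℝ)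
    (hx : ∀ i, HasDerivAt (x i) (x' i) t)
    (hode : x' = A *ᵥ (fun i => x i t)
      - B *ᵥ (fun k => Real.sin (δs k + (C *ᵥ fun i => x i t) k) - Real.sin (δs k))) :
    HasDerivAt
      (fun s => 1 / 2 * ((fun i => x i s) ⬝ᵥ (Q *ᵥ fun i => x i s))
        - ∑ k, kK k * (Real.cos (δs k + (C *ᵥ fun i => x i s) k)
            + (δs k + (C *ᵥ fun i => x i s) k) * Real.sin (δs k)))
      (1 / 2 * ((fun i => x i t) ⬝ᵥ ((Aᵀ * Q + Q * A) *ᵥ fun i => x i t))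
        - (fun i => x i t) ⬝ᵥ (Q *ᵥ (B *ᵥ
            (fun k => Real.sin (δs k + (C *ᵥ fun i => x i t) k) - Real.sin (δs k))))
        + (fun k => Real.sin (δs k + (C *ᵥ fun i => x i t) k) - Real.sin (δs k))
            ⬝ᵥ (diagonal kK *ᵥ (C *ᵥ (A *ᵥ (fun i => x i t) - B *ᵥ
              (fun k => Real.sin (δs k + (C *ᵥ fun i => x i t) k) - Real.sin (δs k)))))) t := by
  set xt : ι → ℝ := fun i => x i t with hxt
  set F : κ → ℝ := fun k => Real.sin (δs k + (C *ᵥ xt) k) - Real.sin (δs k) with hF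
  have hQij : ∀ i j, Q j i = Q i j := fun i j => by
    have := congrFun (congrFun hQ i) j
    simpa [transpose_apply] using this
  -- (1) the quadratic part: d/dt ½ xᵀQx = xᵀ Q x'
  have hquad_fun : (fun s => (fun i => x i s) ⬝ᵥ (Q *ᵥ fun i => x i s))
      = fun s => ∑ i, ∑ j, x i s * (Q i j * x j s) := by
    funext s
    simp only [dotProduct, mulVec, Finset.mul_sum]
  have hquad : HasDerivAt (fun s => (fun i => x i s) ⬝ᵥ (Q *ᵥ fun i => x i s))
      (2 * (xt ⬝ᵥ (Q *ᵥ x'))) t := by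
    rw [hquad_fun]
    have hd : HasDerivAt (fun s => ∑ i, ∑ j, x i s * (Q i j * x j s))
        (∑ i, ∑ j, (x' i * (Q i j * x j t) + x i t * (Q i j * x' j))) t := by
      apply HasDerivAt.fun_sum
      intro i _
      apply HasDerivAt.fun_sum
      intro j _
      exact (hx i).mul ((hx j).const_mul (Q i j))
    refine hd.congr_deriv ?_
    have hswap : ∑ i, ∑ j, x' i * (Q i j * x j t) = ∑ i, ∑ j, x i t * (Q i j * x' j) := by
      rw [Finset.sum_comm]
      refine Finset.sum_congr rfl fun i _ => Finset.sum_congr rfl fun j _ => ?_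
      rw [hQij i j]
      ring
    have hdot : xt ⬝ᵥ (Q *ᵥ x') = ∑ i, ∑ j, x i t * (Q i j * x' j) := by
      simp only [hxt, dotProduct, mulVec, Finset.mul_sum]
    rw [Finset.sum_congr rfl fun i _ => Finset.sum_add_distrib, Finset.sum_add_distrib, hswap,
      hdot]
    ring
  -- (2) the edge angles: δ_k(s) = δs_k + (C x(s))_k has derivative (C x')_k
  have hδ : ∀ k, HasDerivAt (fun s => δs k + (C *ᵥ fun i => x i s) k) ((C *ᵥ x') k) t := by
    intro k
    have hC : HasDerivAt (fun s => (C *ᵥ fun i => x i s) k) ((C *ᵥ x') k) t := by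
      have hfun : (fun s => (C *ᵥ fun i => x i s) k) = fun s => ∑ i, C k i * x i s := by
        funext s; simp only [mulVec, dotProduct]
      have hval : (C *ᵥ x') k = ∑ i, C k i * x' i := by simp only [mulVec, dotProduct]
      rw [hfun, hval]
      exact HasDerivAt.fun_sum fun i _ => (hx i).const_mul (C k i)
    exact hC.const_add (δs k)
  -- (3) the nonlinear part: d/dt Σ K_k (cos δ_k + δ_k sin δs_k) = −Σ K_k F_k (C x')_k
  have hnl : HasDerivAt (fun s => ∑ k, kK k * (Real.cos (δs k + (C *ᵥ fun i => x i s) k)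
        + (δs k + (C *ᵥ fun i => x i s) k) * Real.sin (δs k)))
      (∑ k, kK k * (-Real.sin (δs k + (C *ᵥ xt) k) * (C *ᵥ x') k
        + (C *ᵥ x') k * Real.sin (δs k))) t := by
    apply HasDerivAt.fun_sum
    intro k _
    exact (((hδ k).cos).add ((hδ k).mul_const (Real.sin (δs k)))).const_mul (kK k)
  have h := (hquad.const_mul (1 / 2)).sub hnl
  refine h.congr_deriv ?_
  -- algebra: ½·2·xᵀQx' − Σ K_k(−sin δ_k + sin δs_k)(Cx')_k = ½xᵀ(AᵀQ+QA)x − xᵀQBF + FᵀK C x'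
  have hx' : xt ⬝ᵥ (Q *ᵥ x') = 1 / 2 * (xt ⬝ᵥ ((Aᵀ * Q + Q * A) *ᵥ xt)) - xt ⬝ᵥ (Q *ᵥ (B *ᵥ F)) := by
    rw [hode, mulVec_sub, dotProduct_sub, add_mulVec, ← mulVec_mulVec, ← mulVec_mulVec,
      dotProduct_add, dot_transpose_mulVec A xt (Q *ᵥ xt),
      dot_mulVec_eq_transpose Q xt (A *ᵥ xt), hQ, dotProduct_comm (Q *ᵥ xt) (A *ᵥ xt)]
    ring
  have hnl' : ∑ k, kK k * (-Real.sin (δs k + (C *ᵥ xt) k) * (C *ᵥ x') k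
        + (C *ᵥ x') k * Real.sin (δs k))
      = -(F ⬝ᵥ (diagonal kK *ᵥ (C *ᵥ x'))) := by
    rw [dotProduct, ← Finset.sum_neg_distrib]
    refine Finset.sum_congr rfl fun k _ => ?_
    rw [mulVec_diagonal, hF]
    ring
  rw [hnl', hx', hode]
  ring

/-- **LFF decay along trajectories in the polytope** (Vu–Turitsyn 2016, the «central result»:
«The Lyapunov function V(x) defined by (Lyapunov) is strictly decaying inside the polytope P
defined by the set of inequalities |δ_kj + δ*_kj| < π» — typed in the non-strict form `V̇ ≤ 0`
that Appendix A proves): for a solution of `ẋ = Ax − BF(Cx)` with the sinusoidal couplings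
`F_k = sin δ_k − sin δ*_k`, `δ_k = δ*_k + (Cx)_k`, symmetric `Q`, diagonal `K = diag kK` and
`H = diag h` with `h ≥ 0`, `CB = 0`, the LMI `−[[AᵀQ+QA, R],[Rᵀ,−2H]] ⪰ 0` with
`R = QB − CᵀH − (KCA)ᵀ`, SEP edge values `|δ*_k| ≤ π/2`, and the state in the polytope
`|δ_k(t) + δ*_k| ≤ π`, the derivative of `V` at `t` is `≤ 0`.
[cite: VuTuritsyn2016, §III (central result) and Appendix A] -/
theorem lyapunov_deriv_nonpos [DecidableEq κ] (A Q : Matrix ι ι ℝ) (B : Matrix ι κ ℝ)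
    (C : Matrix κ ι ℝ) (kK h δs : κ → ℝ) (R : Matrix ι κ ℝ) (L : Matrix (ι ⊕ κ) (ι ⊕ κ) ℝ)
    (hQ : Qᵀ = Q) (hCB : C * B = 0)
    (hR : R = Q * B - Cᵀ * diagonal h - (diagonal kK * C * A)ᵀ)
    (hL : L = Matrix.fromBlocks (Aᵀ * Q + Q * A) R Rᵀ (-(2 : ℝ) • diagonal h))
    (hneg : (-L).PosSemidef) (hh : ∀ k, 0 ≤ h k) (hδs : ∀ k, |δs k| ≤ Real.pi / 2)
    (x : ι → ℝ → ℝ) (x' : ι → ℝ) (t : ℝ) (hx : ∀ i, HasDerivAt (x i) (x' i) t)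
    (hode : x' = A *ᵥ (fun i => x i t)
      - B *ᵥ (fun k => Real.sin (δs k + (C *ᵥ fun i => x i t) k) - Real.sin (δs k)))
    (hP : ∀ k, |(δs k + (C *ᵥ fun i => x i t) k) + δs k| ≤ Real.pi) :
    deriv (fun s => 1 / 2 * ((fun i => x i s) ⬝ᵥ (Q *ᵥ fun i => x i s))
        - ∑ k, kK k * (Real.cos (δs k + (C *ᵥ fun i => x i s) k)
            + (δs k + (C *ᵥ fun i => x i s) k) * Real.sin (δs k))) t ≤ 0 := by
  rw [(lyapunov_hasDerivAt A Q B C kK δs hQ x x' t hx hode).deriv]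
  set xt : ι → ℝ := fun i => x i t with hxt
  set F : κ → ℝ := fun k => Real.sin (δs k + (C *ᵥ xt) k) - Real.sin (δs k) with hF
  have hdiss : 0 ≤ (C *ᵥ xt - F) ⬝ᵥ (diagonal h *ᵥ F) := by
    have h0 := sinusoidal_dissipation_nonneg (fun k => δs k + (C *ᵥ xt) k) δs h hh hδs hP
    have hCx : (C *ᵥ xt - F) = ((fun k => (δs k + (C *ᵥ xt) k) - δs k) - F) := by
      funext k
      simp only [Pi.sub_apply]
      ring
    rw [hCx]
    exact h0
  exact decay_nonpos_of_lmi A Q B C (diagonal kK) (diagonal h) R L hCB hR hL hneg xt F hdiss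

end Literature.MathematicalPhysics.PowerSystems.LyapunovFunctionFamily
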